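/-
Copyright (c) 2026 the pub-hodgecm-mathlib formalisation cell (harness21).  Prover seat hodgecm-mathlib-K2E3-p33 (g0), HCML Track B «K2-LIT»
(build stream 29), h413 = `stmt-HodgeConjecture-24833`, line `K2_E3_EllipticInputs`, unit U12 «Characters», CLOSE-OUT strike line L4 `stub_StCharTS`, letter (SC-an)₂
(PART «SC» :98) — THE LETTER (SHELL₂) OF THE (M5h)₂ PAYER: the `N = 2` twin of ★ (M5h) FILE A §1 `K2E3SupercuspidalTruncatedCharWeightKit.exists_const_integral_heightBall_norm_conj_le_shell_place`
(binder desk K2E3-p23 (g7) `K2/STATUS.md` 2026-09-04T15:13:12Z∕15:19:22Z; LINE-LEAD K2E3-plan (g4); the ambient shell bound = K2E3-p34 (g0) D150).  2026-09-04.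
-/
import Summits.HodgeConjecture.HodgeConjecture.Theorems.K2E3SupercuspBallBoundSplitAssemblyTwo          -- ★ D150 (K2E3-p34 g0) (M5e-1‴)₂: `exists_const_integral_heightBall_norm_conj_le_shell_frozen` (the ambient shell bound on `U(σ, Φ₂)(K)`, frozen `N = 3` constants `42m ∕ 16τ`)
import Summits.HodgeConjecture.HodgeConjecture.Theorems.K2E3SupercuspidalTruncatedCharWeightKitTwo        -- ★ p861141 (K2E3-p29 g0) WeightKit₂ (token shape of record); brings the ★ `Fin 3` template (M5h) FILE A and its Literature kit (`exists_skew_ne_zero_adicCompletion`, `secondCountableTopology_adicCompletion`, `galAdicCompletionMap` lemmas)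
import Summits.HodgeConjecture.HodgeConjecture.Theorems.K2E3SupercuspModelFrameAtPlaceTwo                 -- ★ (K2E3-p31 g0) [M2a]₂: `locallyCompactSpace_unitaryGroupOfForm_adicCompletion`, `isMulRightInvariant_of_isHaarMeasure_of_eq_over` (unimodularity at the place); brings ★ [M2a] generic `secondCountableTopology_unitaryGroupOfForm_adicCompletion`
import Summits.HodgeConjecture.HodgeConjecture.Theorems.K2E3SplitTorusQuotientMeasureTwo                   -- ★ (K2E3-p28 g0): `exists_smulInvariantMeasure_quotient_torusU_place` at `Fin 2`; brings the `{N}`-generic ★ `K2E3SplitTorusQuotientMeasure.{locallyCompactSpace_torusU, secondCountableTopology_torusU, exists_isHaarMeasure_torusU}`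
import Summits.HodgeConjecture.HodgeConjecture.Theorems.K2E3SplitTorusOrbitalBoundPlaceTwo                 -- ★ (K2E3-p28 g0): `exists_isCompact_subgroup_mul_borelU_of_eq_over` (`U(σ_w, Φ₂)(L_w) = K₁ · B`, `K₁` compact)
import HarnessLib

/-!
# K2_E3 road (h413), letter (SC-an)₂: (SHELL₂) — THE SPLIT SHELL BOUND AT THE PLACE FOR `U(σ_w, Φ₂)(L_w)`, BINDER-FREE
# (Harish-Chandra 1970, Part VII §3 pp. 71–72, Theorem 19 p. 70; Part VI §8 Theorem 14 p. 60; Rogawski 1990, §7.3 p. 97)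

Cell `pub/hodgecm-mathlib`, Track B «K2-LIT», crux H413 = `stmt-HodgeConjecture-24833` (`--supports … --as helper`, count-neutral).  THEOREMS ONLY (no `def`, no
`instance`, no `notation`, no named-fact hypothesis, no `sorry`).

WHAT.  The TOP (M5h)₂ payer ★ p861288 `K2E3SupercuspidalTruncatedCharAnalyticTwoOfEllWeight.sigSCanTwo_of_ellWeightPlace_two (hLIM hSHELL hTOK hTORΩ hDEPTH)` (K2E3-p23 (g7))
turns the (M5h)₂ socket of PART «SC» into a theorem REL over five ∀-closed `N = 2` letters; (TORΩ₂)∕(DEPTH₂) are ★ p861268 (this seat).  This file PAYS **(SHELL₂)**: its ONE theorem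
`exists_const_integral_heightBall_norm_conj_le_shell_place` has EXACTLY the payer's binder type `hSHELL` (tree `…AnalyticTwoOfEllWeight.lean` :108–:131, extracted by script),
so the payer docks BY NAME (`hSHELL := K2E3SupercuspidalTruncatedCharWeightKitShellTwo.exists_const_integral_heightBall_norm_conj_le_shell_place`).

THE MATHEMATICS (= the `Fin 3` template ★ (M5h) FILE A §1, token for token at `2 × 2`).  On `U = U(σ_w, Φ₂)(L_w)` (`w ∣ v` non-split) with a Haar measure `ν`, the height balls `Ω`
(`hmem` `hinv` `hmul`) and a support height `m_θ`, there is ONE `C : ℝ≥0` with, for every continuous `θ : U → ℂ` supported in `Ω m_θ` and bounded by `M`, every `t = diag d ∈ T`,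
every `g = y t y⁻¹ ∈ Ω m`, every shell index `τ` with `‖ϖ‖^τ ≤ T(g) = √√(‖disc χ_g‖·‖det g‖⁻²)` and every `R`:
`∫_{Ω R} ‖θ(x g x⁻¹)‖ dν ≤ C·M·(2(R + 42m + 2m_θ + 16τ) + 1)·q^m·T(g)⁻¹` — ★ D150 `K2E3SupercuspBallBoundSplitAssemblyTwo.exists_const_integral_heightBall_norm_conj_le_shell_frozen`
(the honest `2 × 2` constant is `18m`; the payer froze the template's `42m`, and D150 exports both) with its structural binders DISCHARGED at the place: unimodularity `hunimod`
(★ [M2a]₂ `isMulRightInvariant_of_isHaarMeasure_of_eq_over`), the Iwasawa compact `K₁, hKB` (★ `K2E3SplitTorusOrbitalBoundPlaceTwo.exists_isCompact_subgroup_mul_borelU_of_eq_over`),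
a Haar measure `ρ_T ≠ 0` on the diagonal torus (★ generic `exists_isHaarMeasure_torusU`), a non-zero invariant Radon measure on `U ⧸ T` (★
`K2E3SplitTorusQuotientMeasureTwo.exists_smulInvariantMeasure_quotient_torusU_place`), `σ_w ≠ id` (★ `exists_skew_ne_zero_adicCompletion`), `2 ≠ 0` (characteristic zero).

HONEST LABEL: HC_CM is proved only modulo the 7 printed citations (2 remaining named inputs: hLiu418 = `stmt-HodgeConjecture-24832`, h413 =
`stmt-HodgeConjecture-24833`) until rung 0 closes; this file is a count-neutral helper; after it (M5h)₂ is REL over {LIM₂, TOK₂} — REL ≠ ★.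

## References
* [HarishChandra1970] Harish-Chandra (notes by G. van Dijk), *Harmonic Analysis on Reductive p-adic Groups*, LNM 162 (1970), Part VI §8 Theorem 14 p. 60; Part VII §2 p. 69,
  §3 pp. 71–72, Theorem 19 p. 70.
* [Rogawski1990] J. D. Rogawski, *Automorphic Representations of Unitary Groups in Three Variables*, Ann. of Math. Stud. 123 (1990), §4.9 p. 54, §7.3 p. 97.
* [DeitmarEchterhoff2014] A. Deitmar, S. Echterhoff, *Principles of Harmonic Analysis*, 2nd ed. (2014), Thm. 1.5.3 (invariant measures on quotients).
-/

set_option autoImplicit false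
-- the mandated namespace repeats the single-problem summit's segment (`HodgeConjecture.HodgeConjecture`)
set_option linter.dupNamespace false

noncomputable section

open MeasureTheory Measure Set Filter Topology NumberField IsDedekindDomain
open scoped NNReal ENNReal Pointwise Matrix MatrixGroups WithZero
open ValuativeRel
open Literature.NumberTheory.Automorphic Literature.NumberTheory.Automorphic.UnitaryGroup Literature.NumberTheory.Automorphic.HermitianLattice Literature.NumberTheory.Rogawski1990
open Literature.NumberTheory.GaloisRepresentations Literature.NumberTheory.GaloisRepresentations.IsNonarchimedeanLocalField

namespace Summit.HodgeConjecture.HodgeConjecture.Cruxes.H413.K2E3SupercuspidalTruncatedCharWeightKitShellTwo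

set_option maxHeartbeats 1600000 in -- long ∀-closed statement (the payer's letter type verbatim) and the instance-heavy frame of `L_w` ∕ `U(σ_w, Φ₂)(L_w)`
open scoped Classical in
/-- **(SHELL₂) — (M5e-1‴)₂ AT THE PLACE, BINDER-FREE; THE PAYER'S LETTER `hSHELL`, BYTE-EXACT**: on `U = U(σ_w, Φ₂)(L_w)` with a Haar measure `ν`, the height balls `Ω`
(`hmem` `hinv` `hmul`) and a support height `m_θ`, there is ONE `C : ℝ≥0` with, for every continuous `θ : U → ℂ` supported in `Ω m_θ` and bounded by `M`, every `t = diag d ∈ T`,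
every `g = y t y⁻¹ ∈ Ω m`, every shell index `τ` with `‖ϖ‖^τ ≤ T(g)` and every `R`: `∫_{Ω R} ‖θ(x g x⁻¹)‖ dν ≤ C·M·(2(R + 42m + 2m_θ + 16τ) + 1)·q^m·T(g)⁻¹` — ★ D150
`exists_const_integral_heightBall_norm_conj_le_shell_frozen` with `hunimod` (★ [M2a]₂), `K₁, hKB` (★ `…OrbitalBoundPlaceTwo`), `ρ_T` (★ `exists_isHaarMeasure_torusU`), `μQ ≠ 0`
(★ `…QuotientMeasureTwo`), `σ_w ≠ id` (★ `exists_skew_ne_zero_adicCompletion`) discharged.  [cite: HarishChandra1970, Part VII §3 pp. 71–72; Part VI §8 Theorem 14 p. 60]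
[cite: Rogawski1990, §7.3 p. 97] [cite: DeitmarEchterhoff2014, Thm. 1.5.3] -/
theorem exists_const_integral_heightBall_norm_conj_le_shell_place :
    ∀ (L : Type) [Field L] [NumberField L] [IsCMField L] {v : HeightOneSpectrum (𝓞 ↥(maximalRealSubfield L))} (w : PlacesOver L v) (hw : IsCMField.complexConj L • w.1 = w.1)
          [MeasurableSpace ↥(unitaryGroupOfForm (galAdicCompletionMap (L := L) (IsCMField.complexConj L) hw) ((StdForm.antidiagonal 2).over (w.1.adicCompletion L)))]
          [BorelSpace ↥(unitaryGroupOfForm (galAdicCompletionMap (L := L) (IsCMField.complexConj L) hw) ((StdForm.antidiagonal 2).over (w.1.adicCompletion L)))]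
          (ν : Measure ↥(unitaryGroupOfForm (galAdicCompletionMap (L := L) (IsCMField.complexConj L) hw) ((StdForm.antidiagonal 2).over (w.1.adicCompletion L)))) [ν.IsHaarMeasure]
          (Ω : CompactExhaustion ↥(unitaryGroupOfForm (galAdicCompletionMap (L := L) (IsCMField.complexConj L) hw) ((StdForm.antidiagonal 2).over (w.1.adicCompletion L)))) {ϖ : w.1.adicCompletion L}
          (hϖ : Valued.v ϖ = WithZero.exp (-1 : ℤ))
          (hmem : ∀ (m : ℕ) (g : ↥(unitaryGroupOfForm (galAdicCompletionMap (L := L) (IsCMField.complexConj L) hw) ((StdForm.antidiagonal 2).over (w.1.adicCompletion L)))), g ∈ Ω m ↔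
            (∀ i j, Valued.v (ϖ ^ m * ((g : GL (Fin 2) (w.1.adicCompletion L)) : Matrix (Fin 2) (Fin 2) (w.1.adicCompletion L)) i j) ≤ 1) ∧
              ∀ i j, Valued.v (ϖ ^ m * (((g : GL (Fin 2) (w.1.adicCompletion L))⁻¹ : GL (Fin 2) (w.1.adicCompletion L)) : Matrix (Fin 2) (Fin 2) (w.1.adicCompletion L)) i j) ≤ 1)
          (hinv : ∀ (m : ℕ) (g : ↥(unitaryGroupOfForm (galAdicCompletionMap (L := L) (IsCMField.complexConj L) hw) ((StdForm.antidiagonal 2).over (w.1.adicCompletion L)))), g ∈ Ω m → g⁻¹ ∈ Ω m)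
          (hmul : ∀ (a b : ℕ) (g h : ↥(unitaryGroupOfForm (galAdicCompletionMap (L := L) (IsCMField.complexConj L) hw) ((StdForm.antidiagonal 2).over (w.1.adicCompletion L)))), g ∈ Ω a → h ∈ Ω b → g * h ∈ Ω (a + b))
          (mθ : ℕ),
          ∃ C : ℝ≥0, ∀ (θ : ↥(unitaryGroupOfForm (galAdicCompletionMap (L := L) (IsCMField.complexConj L) hw) ((StdForm.antidiagonal 2).over (w.1.adicCompletion L))) → ℂ), Continuous θ → (∀ g, θ g ≠ 0 → g ∈ Ω mθ) →
            ∀ (M : ℝ≥0), (∀ g, ‖θ g‖₊ ≤ M) →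
            ∀ (t : ↥(torusU (galAdicCompletionMap (L := L) (IsCMField.complexConj L) hw) ((StdForm.antidiagonal 2).over (w.1.adicCompletion L)))) (d : Fin 2 → (w.1.adicCompletion L)ˣ),
              glDiagonal 2 (w.1.adicCompletion L) d = ((t : ↥(unitaryGroupOfForm (galAdicCompletionMap (L := L) (IsCMField.complexConj L) hw) ((StdForm.antidiagonal 2).over (w.1.adicCompletion L)))) : GL (Fin 2) (w.1.adicCompletion L)) →
              ∀ (g y : ↥(unitaryGroupOfForm (galAdicCompletionMap (L := L) (IsCMField.complexConj L) hw) ((StdForm.antidiagonal 2).over (w.1.adicCompletion L)))) (m : ℕ), g ∈ Ω m →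
                g = y * (t : ↥(unitaryGroupOfForm (galAdicCompletionMap (L := L) (IsCMField.complexConj L) hw) ((StdForm.antidiagonal 2).over (w.1.adicCompletion L)))) * y⁻¹ →
              ∀ (τ : ℕ), normAbs (w.1.adicCompletion L) ϖ ^ τ ≤ NNReal.sqrt (NNReal.sqrt
                  (normAbs (w.1.adicCompletion L) (((g : GL (Fin 2) (w.1.adicCompletion L)) : Matrix (Fin 2) (Fin 2) (w.1.adicCompletion L))).charpoly.discr *
                    (normAbs (w.1.adicCompletion L) (((g : GL (Fin 2) (w.1.adicCompletion L)) : Matrix (Fin 2) (Fin 2) (w.1.adicCompletion L))).det ^ 2)⁻¹)) → ∀ (R : ℕ),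
                ∫ x in Ω R, ‖θ (x * g * x⁻¹)‖ ∂ν ≤ C * M * ((2 * (R + 42 * m + 2 * mθ + 16 * τ) + 1 : ℕ) : ℝ) * ((residueFieldCard (w.1.adicCompletion L) : ℝ≥0) : ℝ) ^ m * ((NNReal.sqrt (NNReal.sqrt
                      (normAbs (w.1.adicCompletion L) (((g : GL (Fin 2) (w.1.adicCompletion L)) : Matrix (Fin 2) (Fin 2) (w.1.adicCompletion L))).charpoly.discr *
                        (normAbs (w.1.adicCompletion L) (((g : GL (Fin 2) (w.1.adicCompletion L)) : Matrix (Fin 2) (Fin 2) (w.1.adicCompletion L))).det ^ 2)⁻¹)))⁻¹ : ℝ) := by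
  intro L _ _ _ v w hw _ _ ν _ Ω ϖ hϖ hmem hinv hmul mθ
  -- the frame of `L_w` and `U`
  letI : MeasurableSpace (w.1.adicCompletion L) := borel _
  haveI : BorelSpace (w.1.adicCompletion L) := ⟨rfl⟩
  haveI : SecondCountableTopology (w.1.adicCompletion L) := secondCountableTopology_adicCompletion L w.1
  haveI : CharZero (w.1.adicCompletion L) := charZero_of_injective_algebraMap (algebraMap L (w.1.adicCompletion L)).injective
  haveI : SecondCountableTopology ↥(unitaryGroupOfForm (galAdicCompletionMap (L := L) (IsCMField.complexConj L) hw) ((StdForm.antidiagonal 2).over (w.1.adicCompletion L))) :=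
    K2E3SupercuspModelFrameAtPlace.secondCountableTopology_unitaryGroupOfForm_adicCompletion L w _ _
  haveI : LocallyCompactSpace ↥(unitaryGroupOfForm (galAdicCompletionMap (L := L) (IsCMField.complexConj L) hw) ((StdForm.antidiagonal 2).over (w.1.adicCompletion L))) :=
    K2E3SupercuspModelFrameAtPlaceTwo.locallyCompactSpace_unitaryGroupOfForm_adicCompletion L w hw _
  haveI : ν.IsMulRightInvariant := K2E3SupercuspModelFrameAtPlaceTwo.isMulRightInvariant_of_isHaarMeasure_of_eq_over L w hw rfl ν
  have hσσ : ∀ x, galAdicCompletionMap (L := L) (IsCMField.complexConj L) hw (galAdicCompletionMap (L := L) (IsCMField.complexConj L) hw x) = x :=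
    galAdicCompletionMap_galAdicCompletionMap_of_smul_eq (IsCMField.complexConj L) w (IsCMField.complexConj_ne_one L) hw
  have hσc : Continuous (galAdicCompletionMap (L := L) (IsCMField.complexConj L) hw) := continuous_galAdicCompletionMap L (IsCMField.complexConj L) hw
  have hσv : ∀ x, Valued.v (galAdicCompletionMap (L := L) (IsCMField.complexConj L) hw x) = Valued.v x :=
    fun x => valued_galAdicCompletionMap (L := L) (IsCMField.complexConj L) hw x
  have hσ1 : ∃ x, galAdicCompletionMap (L := L) (IsCMField.complexConj L) hw x ≠ x := by
    obtain ⟨δ, hσδ, hδ⟩ := exists_skew_ne_zero_adicCompletion (IsCMField.complexConj L) (IsCMField.complexConj_ne_one L) w hw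
    refine ⟨δ, fun hfix => hδ ?_⟩
    have h2 : (2 : w.1.adicCompletion L) * δ = 0 := by linear_combination hfix.symm.trans hσδ
    exact (mul_eq_zero.mp h2).resolve_left two_ne_zero
  -- the torus `T`, its Haar measure, a non-zero invariant Radon measure on `U ⧸ T`, the Iwasawa compact
  haveI := K2E3SplitTorusQuotientMeasure.locallyCompactSpace_torusU (galAdicCompletionMap (L := L) (IsCMField.complexConj L) hw)
    ((StdForm.antidiagonal 2).over (w.1.adicCompletion L))
  haveI := K2E3SplitTorusQuotientMeasure.secondCountableTopology_torusU (galAdicCompletionMap (L := L) (IsCMField.complexConj L) hw)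
    ((StdForm.antidiagonal 2).over (w.1.adicCompletion L))
  obtain ⟨ρT, hρT⟩ := K2E3SplitTorusQuotientMeasure.exists_isHaarMeasure_torusU (galAdicCompletionMap (L := L) (IsCMField.complexConj L) hw)
    ((StdForm.antidiagonal 2).over (w.1.adicCompletion L))
  haveI := hρT
  have hρ0 : ρT ≠ 0 := fun h => by
    have h1 := (isOpen_univ (X := ↥(torusU (galAdicCompletionMap (L := L) (IsCMField.complexConj L) hw) ((StdForm.antidiagonal 2).over (w.1.adicCompletion L))))).measure_ne_zero ρT Set.univ_nonempty
    rw [h] at h1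
    exact h1 rfl
  letI : MeasurableSpace (↥(unitaryGroupOfForm (galAdicCompletionMap (L := L) (IsCMField.complexConj L) hw) ((StdForm.antidiagonal 2).over (w.1.adicCompletion L))) ⧸ torusU (galAdicCompletionMap (L := L) (IsCMField.complexConj L) hw) ((StdForm.antidiagonal 2).over (w.1.adicCompletion L))) :=
    borel _
  haveI : BorelSpace (↥(unitaryGroupOfForm (galAdicCompletionMap (L := L) (IsCMField.complexConj L) hw) ((StdForm.antidiagonal 2).over (w.1.adicCompletion L))) ⧸ torusU (galAdicCompletionMap (L := L) (IsCMField.complexConj L) hw) ((StdForm.antidiagonal 2).over (w.1.adicCompletion L))) :=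
    ⟨rfl⟩
  obtain ⟨μQ, hQinv, hQfin, hQ0⟩ := K2E3SplitTorusQuotientMeasureTwo.exists_smulInvariantMeasure_quotient_torusU_place L w hw rfl
  haveI := hQinv
  haveI := hQfin
  obtain ⟨K₁, hK₁, hKB⟩ := K2E3SplitTorusOrbitalBoundPlaceTwo.exists_isCompact_subgroup_mul_borelU_of_eq_over L w hw rfl
  exact K2E3SupercuspBallBoundSplitAssemblyTwo.exists_const_integral_heightBall_norm_conj_le_shell_frozen
    (galAdicCompletionMap (L := L) (IsCMField.complexConj L) hw) hσv rfl hσσ hσc hσ1 two_ne_zero hϖ ν ρT μQ Ω hmem hinv hmul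
    (fun ν' hν' => K2E3SupercuspModelFrameAtPlaceTwo.isMulRightInvariant_of_isHaarMeasure_of_eq_over L w hw rfl ν') hK₁ hKB hQ0 hρ0 mθ

end Summit.HodgeConjecture.HodgeConjecture.Cruxes.H413.K2E3SupercuspidalTruncatedCharWeightKitShellTwo

end
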